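import Mathlib
import HarnessLib
import Literature.MathematicalPhysics.StatisticalMechanics.WeightDataABKM
import Literature.MathematicalPhysics.StatisticalMechanics.TorusFRDModeData

/-!
# Domination of the [ABKM19] weight tower on the torus with `N`-independent parameters
# (Lemma 7.5 (i),(v) ⇒ Theorem 7.1 (w1), (w2), (w7) inputs for `abkmWeightData`)

`WeightDataOfFRD.dominated_frdWeightData` proves `WeightData.Dominated` for the weight data of a
finite-range decomposition from a long list of scalar hypotheses (shell bounds of the multipliers,
a parameter schedule `θ_k, δ'_k, μ, k₀`, a scale-`0` condition); `exists_schedule`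
(`WeightDominatingSchedule.lean`) produces such a schedule for each `N`.  For the renormalisation
group the parameters must not depend on the number of scales `N` (the constants `δ(L)`, `λ`,
`μ(λ,L)` of [ABKM19] Lemma 7.3 / (7.41) depend on `L` only).  This file

* isolates the `N`-INDEPENDENT core of the schedule — `exists_schedule_core`: `(k₀, μ, δ₁)` with
  `μδ₁ ≤ θ̄`, `δ₁ ≤ (4λ)⁻¹`, the smallness (7.35) beyond `k₀` and the largeness (7.40) for every
  `θ' ∈ [−1, 2θ̄]` — and derives the per-`N` hypotheses of `dominated_frdWeightData` for the
  schedule `θ_k = thetaSeq θ̄ μ δ₁ N k`, `δ'_k = schedDelta δ₀ δ₁ N k` (`δ₀` at scale `0`,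
  `δ₁4^{−k}` for `1 ≤ k ≤ N`, `0` beyond) (`schedule_of_core`);
* chooses the scale-`0` coefficient: `exists_delta0` (`(½ + δ₀K)(1 + 2θ̄ + λ) ≤ 1`);
* **`dominated_abkmWeightData`** — `Dominated` for `abkmWeightData L N Mord R θ̄ δ' 𝒞` from the
  clauses (o), (ii), (v) of the decomposition in the per-mode form of `TorusFRDModeData`
  (`hshell`, evenness, zero mode, symbol inversion), orders `2 ≤ M_ord`, `R ≥ 2`, `L ≥ 2^{d+3}+16R`,
  and the schedule hypotheses; `three_mul_pi_sq_le` supplies `3dπ² ≤ 4(L²−4)`.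

Everything is proved; no named fact.

## References
* S. Adams, S. Buchholz, R. Kotecký, S. Müller, arXiv:1910.13564, Lemma 7.3 (7.35), (7.40),
  Lemma 7.5 (v) (7.41)–(7.45), Theorem 7.1 [AdamsBuchholzKoteckyMuller2019].
-/

noncomputable section

namespace Literature.MathematicalPhysics.StatisticalMechanics.GradientRG

open Finset Real Matrix
open scoped MatrixOrder
open Literature.MathematicalPhysics.StatisticalMechanics.GradientFRD
  (mulMat fourierCoeff cExt InShell ShellBoundsV symbR)

variable {d : ℕ}

/-! ## The `N`-independent core of the parameter schedule -/

/-- **`N`-independent schedule parameters** ([ABKM19] Lemma 7.3: "there is a constant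
`μ(λ, L) ≥ 1`"; (7.35): "`k₀ = k₀(λ)`"; (7.41): `δ_j = 4^{−j}δ`): for the data
`(L, d, n, ñ, s, c, C, λ, ω₀, θ̄)` there are `k₀`, `μ ≥ 0`, `δ₁ > 0` with `μδ₁ ≤ θ̄`, `δ₁ ≤ (4λ)⁻¹`,
the smallness (7.35) for all `e ≥ k₀ + 2`, and the largeness (7.40) for every `θ' ∈ [−1, 2θ̄]`.
[cite: AdamsBuchholzKoteckyMuller2019, Lemma 7.3 (7.35), (7.40)] -/
theorem exists_schedule_core {s : Finset (Fin d → ℕ)} {Mord : ℕ} (hsM : ∀ α ∈ s, ∑ i, α i ≤ Mord)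
    {L : ℝ} (hL : 1 < L) (hd : 1 ≤ d) {n ñ : ℕ} (hn : 2 * (Mord - 1) < d - 1 + n)
    {lam c C ω₀ θbar : ℝ} (hlam : 0 < lam) (hc : 0 < c) (hC : 0 ≤ C) (hω : 0 < ω₀)
    (hθ0 : 0 < θbar) :
    ∃ (k₀ : ℕ) (μ δ₁ : ℝ), 0 ≤ μ ∧ 0 < δ₁ ∧ μ * δ₁ ≤ θbar ∧ δ₁ ≤ (4 * lam)⁻¹ ∧
      (∀ e : ℕ, k₀ + 2 ≤ e →
        4 * (C * L ^ (2 * (d + ñ) + 1)) * (shellConst s L e * (d * π ^ 2)) ≤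
          lam * (L ^ (d - 1 + n)) ^ (e + 1)) ∧
      (∀ θ' : ℝ, -1 ≤ θ' → θ' ≤ 2 * θbar →
        shellConst s L (k₀ + 1) * (d * π ^ 2) *
            ((1 + θ') * (ω₀ * (4 / π ^ 2))⁻¹ + lam * (4 / π ^ 2)⁻¹) ^ 2 ≤
          μ * ((c / L ^ (2 * (d + ñ) + 1)) / (L ^ 2 * (L ^ (d - 1 + n)) ^ (k₀ + 2)))) := by
  obtain ⟨k₀, hk₀⟩ := exists_k0 hsM hL hd (ñ := ñ) hn hlam hC
  have hL0 : 0 < L := by linarith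
  set ω₁ : ℝ := (c / L ^ (2 * (d + ñ) + 1)) / (L ^ 2 * (L ^ (d - 1 + n)) ^ (k₀ + 2)) with hω₁
  have hω₁0 : 0 < ω₁ := by positivity
  set K : ℝ := shellConst s L (k₀ + 1) * (d * π ^ 2) with hK
  have hK0 : 0 ≤ K := mul_nonneg (shellConst_nonneg s hL0.le _) (by positivity)
  set a : ℝ := (ω₀ * (4 / π ^ 2))⁻¹ with ha
  set b : ℝ := lam * (4 / π ^ 2)⁻¹ with hb
  have ha0 : 0 ≤ a := by positivity
  have hb0 : 0 ≤ b := by positivity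
  set μ : ℝ := K * ((1 + 2 * θbar) * a + b) ^ 2 / ω₁ with hμ
  have hμ0 : 0 ≤ μ := by positivity
  set δ₁ : ℝ := min (4 * lam)⁻¹ (θbar / (μ + 1)) with hδ₁
  have hδ₁0 : 0 < δ₁ := lt_min (by positivity) (by positivity)
  refine ⟨k₀, μ, δ₁, hμ0, hδ₁0, ?_, min_le_left _ _, hk₀, fun θ' hθ'1 hθ'2 => ?_⟩
  · have h1 : δ₁ ≤ θbar / (μ + 1) := min_le_right _ _
    have h2 : μ * δ₁ ≤ μ * (θbar / (μ + 1)) := mul_le_mul_of_nonneg_left h1 hμ0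
    have h3 : μ * (θbar / (μ + 1)) ≤ θbar := by
      rw [mul_div_assoc', div_le_iff₀ (by positivity)]; nlinarith
    linarith
  · -- `K ((1+θ') a + b)² ≤ K ((1+2θ̄) a + b)² = μ ω₁`
    have h1 : (1 + θ') * a + b ≤ (1 + 2 * θbar) * a + b := by nlinarith
    have h0 : 0 ≤ (1 + θ') * a + b := add_nonneg (mul_nonneg (by linarith) ha0) hb0
    have h2 : ((1 + θ') * a + b) ^ 2 ≤ ((1 + 2 * θbar) * a + b) ^ 2 := pow_le_pow_left₀ h0 h1 2
    calc K * ((1 + θ') * a + b) ^ 2 ≤ K * ((1 + 2 * θbar) * a + b) ^ 2 :=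
          mul_le_mul_of_nonneg_left h2 hK0
      _ = μ * ω₁ := by rw [hμ]; field_simp

/-- **The schedule `δ'_k`**: `δ₀` at scale `0` (the coefficient of `M_0^X` in the seed), `δ₁4^{−k}`
for `1 ≤ k ≤ N`, `0` beyond the last scale ((7.41)). [cite: AdamsBuchholzKoteckyMuller2019, Lemma 7.5 (7.41)] -/
def schedDelta (δ₀ δ₁ : ℝ) (N k : ℕ) : ℝ :=
  if k = 0 then δ₀ else deltaSeq δ₁ N k

/-- `δ'_0 = δ₀`. [cite: AdamsBuchholzKoteckyMuller2019, Lemma 7.5 (7.41)] -/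
@[simp] theorem schedDelta_zero (δ₀ δ₁ : ℝ) (N : ℕ) : schedDelta δ₀ δ₁ N 0 = δ₀ := if_pos rfl

/-- `δ'_{k+1} = deltaSeq δ₁ N (k+1)`. [cite: AdamsBuchholzKoteckyMuller2019, Lemma 7.5 (7.41)] -/
@[simp] theorem schedDelta_succ (δ₀ δ₁ : ℝ) (N k : ℕ) :
    schedDelta δ₀ δ₁ N (k + 1) = deltaSeq δ₁ N (k + 1) := if_neg (Nat.succ_ne_zero k)

/-- `δ'_k ≥ 0`. [cite: AdamsBuchholzKoteckyMuller2019, Lemma 7.5 (7.41)] -/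
theorem schedDelta_nonneg {δ₀ δ₁ : ℝ} (h₀ : 0 ≤ δ₀) (h₁ : 0 ≤ δ₁) (N k : ℕ) :
    0 ≤ schedDelta δ₀ δ₁ N k := by
  unfold schedDelta; split_ifs
  · exact h₀
  · exact deltaSeq_nonneg h₁ N k

/-- `δ'_k ≤ max δ₀ δ₁`. [cite: AdamsBuchholzKoteckyMuller2019, Lemma 7.5 (7.41)] -/
theorem schedDelta_le {δ₀ δ₁ : ℝ} (h₁ : 0 ≤ δ₁) (N k : ℕ) :
    schedDelta δ₀ δ₁ N k ≤ max δ₀ δ₁ := by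
  unfold schedDelta; split_ifs
  · exact le_max_left _ _
  · exact (deltaSeq_le h₁ N k).trans (le_max_right _ _)

/-- **The per-`N` schedule from the core**: for `θ_k = thetaSeq θ̄ μ δ₁ N k`,
`δ'_k = schedDelta δ₀ δ₁ N k` with `μδ₁ ≤ θ̄ ≤ ½`, `δ₀, δ₁ ≥ 0`, `δ₁ ≤ (4λ)⁻¹`: the recursion (7.41),
`θ̄ ≤ θ_k ≤ 2θ̄ ≤ 1`, `0 ≤ δ'`, `δ'_{k+1} ≤ (4λ)⁻¹`, `μδ'_{k+1} ≤ 1 + θ_k`, `δ'_{k+1} = 0` for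
`k ≥ N`. [cite: AdamsBuchholzKoteckyMuller2019, Lemma 7.5 (7.41)] -/
theorem schedule_of_core {θbar μ δ₀ δ₁ lam : ℝ} (hθ0 : 0 < θbar) (hθ1 : θbar ≤ 1 / 2) (hμ0 : 0 ≤ μ)
    (hδ₀ : 0 ≤ δ₀) (hδ₁ : 0 < δ₁) (hμδ : μ * δ₁ ≤ θbar) (hδlam : δ₁ ≤ (4 * lam)⁻¹) (N : ℕ) :
    (∀ k, thetaSeq θbar μ δ₁ N (k + 1) =
        thetaSeq θbar μ δ₁ N k - μ * schedDelta δ₀ δ₁ N (k + 1)) ∧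
      (∀ k, θbar ≤ thetaSeq θbar μ δ₁ N k) ∧ (∀ k, thetaSeq θbar μ δ₁ N k ≤ 2 * θbar) ∧
      (∀ k, thetaSeq θbar μ δ₁ N k ≤ 1) ∧ (∀ k, 0 ≤ schedDelta δ₀ δ₁ N k) ∧
      (∀ k, schedDelta δ₀ δ₁ N (k + 1) ≤ (4 * lam)⁻¹) ∧
      (∀ k, μ * schedDelta δ₀ δ₁ N (k + 1) ≤ 1 + thetaSeq θbar μ δ₁ N k) ∧
      (∀ k, N ≤ k → schedDelta δ₀ δ₁ N (k + 1) = 0) := by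
  have hmem : ∀ k, θbar ≤ thetaSeq θbar μ δ₁ N k ∧ thetaSeq θbar μ δ₁ N k ≤ 2 * θbar :=
    fun k => thetaSeq_mem hδ₁.le hμ0 (by linarith) N k
  refine ⟨fun k => by rw [schedDelta_succ]; exact thetaSeq_succ θbar μ δ₁ N k,
    fun k => (hmem k).1, fun k => (hmem k).2, fun k => by linarith [(hmem k).2],
    fun k => schedDelta_nonneg hδ₀ hδ₁.le N k, fun k => ?_, fun k => ?_, fun k hk => ?_⟩
  · rw [schedDelta_succ]; exact (deltaSeq_le hδ₁.le N (k + 1)).trans hδlam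
  · rw [schedDelta_succ]
    have h1 : μ * deltaSeq δ₁ N (k + 1) ≤ μ * δ₁ :=
      mul_le_mul_of_nonneg_left (deltaSeq_le hδ₁.le N (k + 1)) hμ0
    linarith [(hmem k).1]
  · rw [schedDelta_succ]; exact deltaSeq_eq_zero hk

/-- **Choice of the scale-`0` coefficient**: for `T = 1 + 2θ̄ + λ < 2` and `K ≥ 0` there is
`δ₀ > 0` with `(½ + δ₀K)·T ≤ 1` (the scale-`0` condition of `dominated_frdWeightData`:
`A_0^X ⪯ D_0`, (7.42)). [cite: AdamsBuchholzKoteckyMuller2019, Lemma 7.5 (7.42)] -/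
theorem exists_delta0 {T K : ℝ} (hT0 : 0 < T) (hT : T < 2) (hK : 0 ≤ K) :
    ∃ δ₀ : ℝ, 0 < δ₀ ∧ (1 / 2 + δ₀ * K) * T ≤ 1 := by
  refine ⟨(2 - T) / (2 * T * (K + 1)), by positivity, ?_⟩
  have hK1 : 0 < K + 1 := by linarith
  have h1 : (2 - T) / (2 * T * (K + 1)) * K ≤ (2 - T) / (2 * T) := by
    rw [div_mul_eq_mul_div, div_le_div_iff₀ (by positivity) (by positivity)]
    nlinarith
  calc (1 / 2 + (2 - T) / (2 * T * (K + 1)) * K) * T ≤ (1 / 2 + (2 - T) / (2 * T)) * T := by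
        nlinarith
    _ = 1 := by field_simp; ring

/-! ## `3dπ² ≤ 4(L² − 4)` from `L ≥ 2^{d+3}` -/

/-- The side condition of (7.34) holds for `L ≥ 2^{d+3}`. [cite: AdamsBuchholzKoteckyMuller2019, Lemma 7.3 (7.34)] -/
theorem three_mul_pi_sq_le {L : ℕ} (hL : 2 ^ (d + 3) ≤ L) :
    3 * (d : ℝ) * π ^ 2 ≤ 4 * ((L : ℝ) ^ 2 - 4) := by
  have hπ : π ^ 2 < 10 := by nlinarith [Real.pi_lt_d2, Real.pi_pos]
  have h2d : d + 3 < 2 ^ (d + 3) := Nat.lt_two_pow_self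
  have hLd : (d : ℝ) + 4 ≤ L := by exact_mod_cast (show d + 4 ≤ L by omega)
  have hL8 : (8 : ℝ) ≤ L := by
    have : (2 : ℕ) ^ 3 ≤ 2 ^ (d + 3) := Nat.pow_le_pow_right (by norm_num) (by omega)
    exact_mod_cast (show 8 ≤ L by omega)
  have hd0 : (0 : ℝ) ≤ d := Nat.cast_nonneg d
  nlinarith

/-! ## `Dominated` for `abkmWeightData` -/

variable {M : ℕ} [NeZero M]

/-- Orders `1 ≤ |α| ≤ M_ord` with `M_ord ≥ 2` contain `e_i` and `2e_i`.
[cite: AdamsBuchholzKoteckyMuller2019, Ch. 7.1 (7.2)] -/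
theorem single_two_mem_diffIndex {Mord : ℕ} (h2 : 2 ≤ Mord) (i : Fin d) :
    (Pi.single i 2 : Fin d → ℕ) ∈ diffIndex d Mord := by
  rw [mem_diffIndex, Finset.sum_pi_single']
  simp only [Finset.mem_univ, if_true]
  exact ⟨by norm_num, h2⟩

/-- **`WeightData.Dominated` for the [ABKM19] weight data on `(ℤ/L^N)^d`** (Lemma 7.5 (i),(v) ⇒
Theorem 7.1 (w1),(w2) and the (w7) margin): from the per-mode form of clauses (o), (ii), (v) of
the finite-range decomposition (`hshell`, evenness, zero mode, symbol inversion for `A = 1`),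
orders `2 ≤ M_ord`, `R ≥ 2`, `L ≥ 2^{d+3} + 16R`, `n ≥ 1`, and a parameter schedule
(`θ_{k+1} = θ_k − μδ'_{k+1}`, `θ̄ ≤ θ_k ≤ 1`, …, `hsmall`, `hlarge` with `ω₀ = 1`, scale-`0`
condition). The dominating sequence is `D_k = mulMat((λm_k⁻¹ + (1+θ_k)Σ_{j>k}c_j)⁻¹)` with
`m_k = derivMul L k {1 ≤ |α| ≤ M_ord}`. [cite: AdamsBuchholzKoteckyMuller2019, Lemma 7.5 (v)] -/
theorem dominated_abkmWeightData {L N Mord R : ℕ} (hR : 2 ≤ R) (hL : 2 ^ (d + 3) + 16 * R ≤ L)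
    (hd : 1 ≤ d) (hMord : 2 ≤ Mord) {n ñ : ℕ} (hn1 : 1 ≤ n) {c C : ℝ} (hc : 0 ≤ c) (hC : 0 ≤ C)
    {𝒞 : ℕ → (Fin d → ZMod M) → ℝ}
    (hshell : ∀ κ : Fin d → ZMod M, κ ≠ 0 → ∃ j', j' ≤ N ∧ InShell L j' κ ∧
      ShellBoundsV d n ñ N j' (L : ℝ) c C (fun j => fourierCoeff (𝒞 j) κ))
    (hf_even : ∀ (κ : Fin d → ZMod M) (j : ℕ), cExt N (fun j => fourierCoeff (𝒞 j) (-κ)) j =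
      cExt N (fun j => fourierCoeff (𝒞 j) κ) j)
    (hf_zero : ∀ j : ℕ, cExt N (fun j => fourierCoeff (𝒞 j) (0 : Fin d → ZMod M)) j = 0)
    (hinv : ∀ κ : Fin d → ZMod M, κ ≠ 0 →
      (∑ j ∈ Icc 1 (N + 1), cExt N (fun j => fourierCoeff (𝒞 j) κ) j) *
        symbR (1 : Matrix (Fin d) (Fin d) ℝ) κ = 1)
    {θbar lam μ : ℝ} {θ δ' : ℕ → ℝ} (hθbar : 0 < 1 + θbar) (hlam : 0 < lam) (hμ0 : 0 ≤ μ)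
    (hθrec : ∀ k, θ (k + 1) = θ k - μ * δ' (k + 1)) (hθlo : ∀ k, θbar ≤ θ k) (hθhi : ∀ k, θ k ≤ 1)
    (hδnn : ∀ k, 0 ≤ δ' k) (hδ : ∀ k, δ' (k + 1) ≤ (4 * lam)⁻¹)
    (hμδ : ∀ k, μ * δ' (k + 1) ≤ 1 + θ k) (hδN : ∀ k, N ≤ k → δ' (k + 1) = 0) {k₀ : ℕ}
    (hsmall : ∀ e : ℕ, k₀ + 2 ≤ e →
      4 * (C * (L : ℝ) ^ (2 * (d + ñ) + 1)) * (shellConst (diffIndex d Mord) (L : ℝ) e * (d * π ^ 2)) ≤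
        lam * ((L : ℝ) ^ (d - 1 + n)) ^ (e + 1))
    (hlarge : ∀ k, shellConst (diffIndex d Mord) (L : ℝ) (k₀ + 1) * (d * π ^ 2) *
        ((1 + θ k) * (1 * (4 / π ^ 2))⁻¹ + lam * (4 / π ^ 2)⁻¹) ^ 2 ≤
      μ * ((c / (L : ℝ) ^ (2 * (d + ñ) + 1)) / ((L : ℝ) ^ 2 * ((L : ℝ) ^ (d - 1 + n)) ^ (k₀ + 2))))
    (hseed0 : (1 / 2 + δ' 0 * ∑ α ∈ diffIndex d Mord, ((4 : ℝ) * d) ^ (∑ i, α i - 1)) *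
      (1 + θ 0 + lam) ≤ 1) :
    (abkmWeightData L N Mord R θbar δ' 𝒞).Dominated
      (fun k => mulMat (domMul lam θ (fun k => derivMul (L : ℝ) k (diffIndex d Mord))
        (tailMul N (fun κ j => fourierCoeff (𝒞 j) κ)) k)) := by
  have hL8 : 2 ^ (d + 3) ≤ L := le_trans (Nat.le_add_right _ _) hL
  have hL2 : 2 ≤ L := le_trans (by
    have : (2 : ℕ) ^ 1 ≤ 2 ^ (d + 3) := Nat.pow_le_pow_right (by norm_num) (by omega)
    simpa using this) hL8
  exact dominated_frdWeightData hL2 hd (n := n) (ñ := ñ) (by omega) hc hC hshell hf_even hf_zero hinv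
    (fun α hα => (mem_diffIndex.1 hα).1) (fun i => single_mem_diffIndex (by omega) i)
    (fun i => single_two_mem_diffIndex hMord i) (three_mul_pi_sq_le hL8) hθbar (thetaMax_pos R d)
    hlam hμ0 hθrec hθlo hθhi hδnn hδ hμδ hδN hsmall hlarge hseed0
    (fun k X x => boxDensity_nonneg _ (by unfold boxWt; positivity) X x)
    (fun k X x => boxDensity_abkm_le hR (by omega) k X x) _

end Literature.MathematicalPhysics.StatisticalMechanics.GradientRG

end
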